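import Mathlib
import HarnessLib
import Summits.NavierStokesRegularity.NavierStokesRegularity.Theorems.UnthreadedRigidityDoorUnthreadedRigidityVirialHornTwoChannelPressure

/-!
# Route `UnthreadedRigidityDoor`, item `UnthreadedRigidity` (W2, stmt-NavierStokesRegularity-27585) — LINE g11-1 «VIRIAL HORN»,
# BRIDGE V for PLATEAU PROFILES («TWO-CHANNEL RIGIDITY»), file 6: THE EULER OPERATORS `eulerOp`, `eulerL4` — LOCAL FAMILIES ARE ANNIHILATED; THE KERNEL OF `L₄` ON `(0,∞)`

Prover file (W2 Lean hand ns-crc-p1 g10, by lineage; `--supports stmt-NavierStokesRegularity-27585 --as helper`; objects BY NAME in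
`Theorems/UnthreadedRigidityDoorUnthreadedRigidityVirialHornTwoChannelDefs.lean`, p726708 / p728780 and its second append).

Content (pure one-variable real analysis): `eulerOp_eventuallyEq_zpow` (`(rD+m)` on local combinations `c₁r^{z₁} + c₂r^{z₂}`);
★ `eulerL4_eq_zero_of_eventuallyEq`: `L₄ = (rD)(rD+l)(rD+l+1)(rD+2l+1)` kills, at `r₀`, every function that agrees near `r₀` with
`c₁r^{z₁} + c₂r^{z₂}` for roots `zᵢ` of `z(z+l)(z+l+1)(z+2l+1)`; `exists_pow_mul_eq_of_eulerOp` (one Euler integration step on `(0,∞)`);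
★ `exists_family_of_eulerL4_eq_zero`: the kernel of `L₄` on `(0,∞)` is `A + Br^{−l} + Cr^{−l−1} + Dr^{−2l−1}`;
`family_coeff_eq_zero_of_bounded` (bounded at the apex ⇒ `B = C = D = 0`), `const_eq_zero_of_virial_decay` (decay ⇒ `A = 0`),
`exists_const_of_sq_const` (constant square + continuity on an interval ⇒ constant, by the intermediate value theorem).
HONEST LABEL: slice-level calculus / real analysis about SPECIAL (separable) data; a piece of the L-part of ONE bridge of a RUNG line on the
wall item; `UnthreadedRigidity` (27585), W2 and NS regularity remain OPEN; nothing here is a statement about Navier–Stokes regularity.  0 kit.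
-/

-- the summit and its single sub-problem share the name (CONVENTIONS §1), as in every Theorems file
set_option linter.dupNamespace false

namespace Summit.NavierStokesRegularity.NavierStokesRegularity.Theorems.UnthreadedRigidity.VirialHorn

open scoped RealInnerProductSpace Topology Laplacian
open Filter Set MvPolynomial
open Literature.Combinatorics.LorentzianPolynomials (pderiv_pderiv_comm)
open Summit.NavierStokesRegularity.NavierStokesRegularity.Theorems.UnthreadedRigidity.ProfileHorn (E3)
open Summit.NavierStokesRegularity.NavierStokesRegularity.Theorems.UnthreadedRigidity.HornPressure (radCoeff)
open Summit.NavierStokesRegularity.NavierStokesRegularity.Theorems.PoloidalLiouville.HorizonTower hiding E3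

/-! ## §7 The Euler operators: local families are annihilated, and the kernel of `L₄` on `(0,∞)` -/

section Euler

open scoped ContDiff

variable {l : ℕ}

/-- `(rD + m)` maps a local combination `c₁ r^{z₁} + c₂ r^{z₂}` (near `r₀ ≠ 0`) to `(z₁+m)c₁ r^{z₁} + (z₂+m)c₂ r^{z₂}`. -/
theorem eulerOp_eventuallyEq_zpow {F : ℝ → ℝ} {r₀ : ℝ} (hr₀ : r₀ ≠ 0) (m c₁ c₂ : ℝ) (z₁ z₂ : ℤ)
    (hF : F =ᶠ[𝓝 r₀] fun r => c₁ * r ^ z₁ + c₂ * r ^ z₂) :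
    eulerOp m F =ᶠ[𝓝 r₀] fun r => (((z₁ : ℝ) + m) * c₁) * r ^ z₁ + (((z₂ : ℝ) + m) * c₂) * r ^ z₂ := by
  have hG : ∀ r : ℝ, r ≠ 0 → HasDerivAt (fun r : ℝ => c₁ * r ^ z₁ + c₂ * r ^ z₂)
      (c₁ * ((z₁ : ℝ) * r ^ (z₁ - 1)) + c₂ * ((z₂ : ℝ) * r ^ (z₂ - 1))) r := fun r hr =>
    ((hasDerivAt_zpow z₁ r (Or.inl hr)).const_mul c₁).add ((hasDerivAt_zpow z₂ r (Or.inl hr)).const_mul c₂)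
  filter_upwards [hF, hF.deriv, eventually_ne_nhds hr₀] with r hFr hdr hr
  unfold eulerOp
  rw [hdr, hFr, (hG r hr).deriv]
  have e1 : r * r ^ (z₁ - 1) = r ^ z₁ := by rw [zpow_sub_one₀ hr]; field_simp
  have e2 : r * r ^ (z₂ - 1) = r ^ z₂ := by rw [zpow_sub_one₀ hr]; field_simp
  calc r * (c₁ * ((z₁ : ℝ) * r ^ (z₁ - 1)) + c₂ * ((z₂ : ℝ) * r ^ (z₂ - 1))) + m * (c₁ * r ^ z₁ + c₂ * r ^ z₂)
      = c₁ * z₁ * (r * r ^ (z₁ - 1)) + c₂ * z₂ * (r * r ^ (z₂ - 1)) + m * (c₁ * r ^ z₁ + c₂ * r ^ z₂) := by ring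
    _ = (((z₁ : ℝ) + m) * c₁) * r ^ z₁ + (((z₂ : ℝ) + m) * c₂) * r ^ z₂ := by rw [e1, e2]; ring

/-- ★ `L₄` ANNIHILATES BOTH LOCAL FAMILIES: if `H` agrees near `r₀ ≠ 0` with `c₁ r^{z₁} + c₂ r^{z₂}` and the exponents are roots of
`z(z+l)(z+l+1)(z+2l+1)`, then `eulerL4 l H r₀ = 0`. -/
theorem eulerL4_eq_zero_of_eventuallyEq (l : ℕ) {H : ℝ → ℝ} {r₀ : ℝ} (hr₀ : r₀ ≠ 0) {c₁ c₂ : ℝ} {z₁ z₂ : ℤ}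
    (hH : H =ᶠ[𝓝 r₀] fun r => c₁ * r ^ z₁ + c₂ * r ^ z₂)
    (hz₁ : (z₁ : ℝ) * ((z₁ : ℝ) + l) * ((z₁ : ℝ) + l + 1) * ((z₁ : ℝ) + 2 * l + 1) = 0)
    (hz₂ : (z₂ : ℝ) * ((z₂ : ℝ) + l) * ((z₂ : ℝ) + l + 1) * ((z₂ : ℝ) + 2 * l + 1) = 0) :
    eulerL4 l H r₀ = 0 := by
  have h3 := eulerOp_eventuallyEq_zpow hr₀ (2 * (l : ℝ) + 1) c₁ c₂ z₁ z₂ hH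
  have h2 := eulerOp_eventuallyEq_zpow hr₀ ((l : ℝ) + 1) _ _ z₁ z₂ h3
  have h1 := eulerOp_eventuallyEq_zpow hr₀ (l : ℝ) _ _ z₁ z₂ h2
  have h0 := eulerOp_eventuallyEq_zpow hr₀ 0 _ _ z₁ z₂ h1
  unfold eulerL4
  rw [h0.eq_of_nhds]
  linear_combination (c₁ * r₀ ^ z₁) * hz₁ + (c₂ * r₀ ^ z₂) * hz₂

/-- `(rD + m)` of a function smooth on `(0,∞)` is smooth on `(0,∞)`. -/
theorem contDiffOn_eulerOp {f : ℝ → ℝ} (hf : ContDiffOn ℝ ∞ f (Ioi 0)) (m : ℝ) : ContDiffOn ℝ ∞ (eulerOp m f) (Ioi 0) := by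
  have hd : ContDiffOn ℝ ∞ (deriv f) (Ioi 0) := hf.deriv_of_isOpen isOpen_Ioi (by simp)
  unfold eulerOp
  exact (contDiffOn_id.mul hd).add (contDiffOn_const.mul hf)

/-- pointwise derivative of `r^n · F` at `r > 0` when `F` is smooth on `(0,∞)`. -/
theorem hasDerivAt_pow_mul {F : ℝ → ℝ} (hF : ContDiffOn ℝ ∞ F (Ioi 0)) (n : ℕ) {r : ℝ} (hr : 0 < r) :
    HasDerivAt (fun x : ℝ => x ^ n * F x) ((n : ℝ) * r ^ (n - 1) * F r + r ^ n * deriv F r) r := by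
  have hFd : DifferentiableAt ℝ F r :=
    ((hF.contDiffAt (Ioi_mem_nhds hr)).differentiableAt (by simp))
  exact ((hasDerivAt_pow n r).mul hFd.hasDerivAt).congr_deriv (by ring)

/-- one EULER INTEGRATION STEP on `(0,∞)`: if `r F′ + m F = G` (`m ≥ 1` a natural number) then `r^m F = Φ + k` for any primitive `Φ` of
`r^{m−1} G`. -/
theorem exists_pow_mul_eq_of_eulerOp {F G Φ : ℝ → ℝ} (hF : ContDiffOn ℝ ∞ F (Ioi 0)) {m : ℕ} (hm : 1 ≤ m)
    (hE : ∀ r : ℝ, 0 < r → eulerOp (m : ℝ) F r = G r)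
    (hΦd : DifferentiableOn ℝ Φ (Ioi 0)) (hΦ : ∀ r : ℝ, 0 < r → deriv Φ r = r ^ (m - 1) * G r) :
    ∃ k : ℝ, ∀ r : ℝ, 0 < r → r ^ m * F r = Φ r + k := by
  have hfd : DifferentiableOn ℝ (fun x : ℝ => x ^ m * F x) (Ioi 0) := fun r hr =>
    (hasDerivAt_pow_mul hF m hr).differentiableAt.differentiableWithinAt
  have hderiv : (Ioi (0:ℝ)).EqOn (deriv (fun x : ℝ => x ^ m * F x)) (deriv Φ) := by
    intro r hr
    rw [(hasDerivAt_pow_mul hF m hr).deriv, hΦ r hr, ← hE r hr]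
    unfold eulerOp
    have : r ^ m = r ^ (m - 1) * r := (pow_sub_one_mul (by omega) r).symm
    rw [this]
    ring
  obtain ⟨k, hk⟩ := isOpen_Ioi.exists_eq_add_of_deriv_eq isPreconnected_Ioi hfd hΦd hderiv
  exact ⟨k, fun r hr => hk hr⟩

/-- ★ THE KERNEL OF `L₄` ON `(0,∞)`: a profile smooth on `(0,∞)` with `eulerL4 l H ≡ 0` there is
`A + B r^{−l} + C r^{−l−1} + D r^{−2l−1}` (`l ≥ 1`). -/
theorem exists_family_of_eulerL4_eq_zero (hl : 1 ≤ l) {H : ℝ → ℝ} (hH : ContDiffOn ℝ ∞ H (Ioi 0))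
    (hL : ∀ r : ℝ, 0 < r → eulerL4 l H r = 0) :
    ∃ A B C D : ℝ, ∀ r : ℝ, 0 < r →
      H r = A + B * (r ^ l)⁻¹ + C * (r ^ (l + 1))⁻¹ + D * (r ^ (2 * l + 1))⁻¹ := by
  set H₃ := eulerOp (2 * (l : ℝ) + 1) H with hH₃
  set H₂ := eulerOp ((l : ℝ) + 1) H₃ with hH₂
  set H₁ := eulerOp (l : ℝ) H₂ with hH₁
  have hH₃c : ContDiffOn ℝ ∞ H₃ (Ioi 0) := contDiffOn_eulerOp hH _
  have hH₂c : ContDiffOn ℝ ∞ H₂ (Ioi 0) := contDiffOn_eulerOp hH₃c _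
  have hH₁c : ContDiffOn ℝ ∞ H₁ (Ioi 0) := contDiffOn_eulerOp hH₂c _
  have hl0 : (l : ℝ) ≠ 0 := by exact_mod_cast (show l ≠ 0 by omega)
  -- step 1: `H₁` is constant
  have hH₁d : DifferentiableOn ℝ H₁ (Ioi 0) := hH₁c.differentiableOn (by simp)
  have hH₁' : (Ioi (0:ℝ)).EqOn (deriv H₁) 0 := by
    intro r hr
    have h := hL r hr
    unfold eulerL4 at h
    rw [← hH₃, ← hH₂, ← hH₁] at h
    unfold eulerOp at h
    have hr0 : (r : ℝ) ≠ 0 := ne_of_gt hr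
    simpa [hr0] using h
  obtain ⟨k₁, hk₁⟩ := isOpen_Ioi.exists_is_const_of_deriv_eq_zero isPreconnected_Ioi hH₁d hH₁'
  -- step 2: `r^l H₂ = (k₁/l) r^l + k₂`
  have hE2 : ∀ r : ℝ, 0 < r → eulerOp ((l : ℕ) : ℝ) H₂ r = (fun _ => k₁) r := fun r hr => hk₁ r hr
  obtain ⟨k₂, hk₂⟩ := exists_pow_mul_eq_of_eulerOp hH₂c hl hE2 (Φ := fun r => k₁ / l * r ^ l)
    ((differentiable_const _).mul (differentiable_pow l)).differentiableOn (fun r hr => by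
      rw [((hasDerivAt_pow l r).const_mul (k₁ / l)).deriv]
      show k₁ / ↑l * (↑l * r ^ (l - 1)) = r ^ (l - 1) * k₁
      field_simp)
  -- step 3: `r^{l+1} H₃ = k₁/(l(l+1)) r^{l+1} + k₂ r + k₃`
  have hE3 : ∀ r : ℝ, 0 < r → eulerOp (((l + 1 : ℕ) : ℝ)) H₃ r = (fun r => k₁ / l + k₂ * (r ^ l)⁻¹) r := by
    intro r hr
    have hr0 : r ≠ 0 := ne_of_gt hr
    have h := hk₂ r hr
    push_cast
    show H₂ r = k₁ / l + k₂ * (r ^ l)⁻¹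
    have hpow : r ^ l ≠ 0 := pow_ne_zero _ hr0
    apply mul_left_cancel₀ hpow
    rw [h]
    field_simp
  obtain ⟨k₃, hk₃⟩ := exists_pow_mul_eq_of_eulerOp hH₃c (m := l + 1) (by omega) hE3
    (Φ := fun r => k₁ / (l * (l + 1)) * r ^ (l + 1) + k₂ * r)
    (((differentiable_const _).mul (differentiable_pow _)).add ((differentiable_const _).mul differentiable_id)).differentiableOn
    (fun r hr => by
      have hr0 : r ≠ 0 := ne_of_gt hr
      have hd : HasDerivAt (fun r : ℝ => k₁ / (l * (l + 1)) * r ^ (l + 1) + k₂ * r)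
          (k₁ / (l * (l + 1)) * (((l + 1 : ℕ) : ℝ) * r ^ (l + 1 - 1)) + k₂ * 1) r :=
        ((hasDerivAt_pow (l + 1) r).const_mul _).add ((hasDerivAt_id r).const_mul k₂)
      rw [hd.deriv, Nat.add_sub_cancel]
      have hpow : r ^ l ≠ 0 := pow_ne_zero _ hr0
      push_cast
      field_simp)
  -- step 4: `r^{2l+1} H = … + k₄`
  have hE4 : ∀ r : ℝ, 0 < r → eulerOp (((2 * l + 1 : ℕ) : ℝ)) H r =
      (fun r => (k₁ / (l * (l + 1)) * r ^ (l + 1) + k₂ * r + k₃) * (r ^ (l + 1))⁻¹) r := by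
    intro r hr
    have hr0 : r ≠ 0 := ne_of_gt hr
    have h := hk₃ r hr
    push_cast
    show H₃ r = (k₁ / (l * (l + 1)) * r ^ (l + 1) + k₂ * r + k₃) * (r ^ (l + 1))⁻¹
    have hpow : r ^ (l + 1) ≠ 0 := pow_ne_zero _ hr0
    apply mul_left_cancel₀ hpow
    rw [h]
    field_simp
  obtain ⟨k₄, hk₄⟩ := exists_pow_mul_eq_of_eulerOp hH (m := 2 * l + 1) (by omega) hE4
    (Φ := fun r => k₁ / (l * (l + 1) * (2 * l + 1)) * r ^ (2 * l + 1) + k₂ / (l + 1) * r ^ (l + 1) + k₃ / l * r ^ l)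
    ((((differentiable_const _).mul (differentiable_pow _)).add ((differentiable_const _).mul (differentiable_pow _))).add
      ((differentiable_const _).mul (differentiable_pow _))).differentiableOn
    (fun r hr => by
      have hr0 : r ≠ 0 := ne_of_gt hr
      have hd : HasDerivAt (fun r : ℝ => k₁ / (l * (l + 1) * (2 * l + 1)) * r ^ (2 * l + 1)
            + k₂ / (l + 1) * r ^ (l + 1) + k₃ / l * r ^ l)
          (k₁ / (l * (l + 1) * (2 * l + 1)) * (((2 * l + 1 : ℕ) : ℝ) * r ^ (2 * l + 1 - 1))
            + k₂ / (l + 1) * (((l + 1 : ℕ) : ℝ) * r ^ (l + 1 - 1)) + k₃ / l * ((l : ℝ) * r ^ (l - 1))) r :=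
        (((hasDerivAt_pow (2 * l + 1) r).const_mul _).add ((hasDerivAt_pow (l + 1) r).const_mul _)).add
          ((hasDerivAt_pow l r).const_mul _)
      rw [hd.deriv]
      simp only [Nat.add_sub_cancel]
      have hpow : r ^ (l + 1) ≠ 0 := pow_ne_zero _ hr0
      have hl1 : ((l : ℝ) + 1) ≠ 0 := by positivity
      have h2l1 : (2 * (l : ℝ) + 1) ≠ 0 := by positivity
      have epow : r ^ (2 * l) = r ^ (l - 1) * r ^ (l + 1) := by rw [← pow_add]; congr 1; omega
      have epow2 : r ^ l = r ^ (l - 1) * r := (pow_sub_one_mul (by omega) r).symm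
      push_cast
      rw [epow, epow2]
      field_simp)
  refine ⟨k₁ / (l * (l + 1) * (2 * l + 1)), k₂ / (l + 1), k₃ / l, k₄, fun r hr => ?_⟩
  have hr0 : r ≠ 0 := ne_of_gt hr
  have h := hk₄ r hr
  have hpow : r ^ (2 * l + 1) ≠ 0 := pow_ne_zero _ hr0
  have hpl : r ^ l ≠ 0 := pow_ne_zero _ hr0
  have hpl1 : r ^ (l + 1) ≠ 0 := pow_ne_zero _ hr0
  have e1 : r ^ (2 * l + 1) = r ^ l * r ^ (l + 1) := by rw [← pow_add]; congr 1; omega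
  have hl1 : ((l : ℝ) + 1) ≠ 0 := by positivity
  have h2l1 : (2 * (l : ℝ) + 1) ≠ 0 := by positivity
  apply mul_left_cancel₀ hpow
  rw [h, e1]
  field_simp

/-- BOUNDED AT THE APEX ⇒ only the constant survives: if `H = A + B r^{−l} + C r^{−l−1} + D r^{−2l−1}` on `(0,∞)` (`l ≥ 1`) is bounded
on `(0,1]`, then `B = C = D = 0`. -/
theorem family_coeff_eq_zero_of_bounded (hl : 1 ≤ l) {H : ℝ → ℝ} {A B C D M : ℝ}
    (hH : ∀ r : ℝ, 0 < r → H r = A + B * (r ^ l)⁻¹ + C * (r ^ (l + 1))⁻¹ + D * (r ^ (2 * l + 1))⁻¹)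
    (hM : ∀ r : ℝ, 0 < r → r ≤ 1 → |H r| ≤ M) : B = 0 ∧ C = 0 ∧ D = 0 := by
  -- a generic squeeze: `r^n H r → 0` as `r → 0⁺` for `n ≥ 1`
  have hsq : ∀ n : ℕ, 1 ≤ n → Tendsto (fun r : ℝ => r ^ n * H r) (𝓝[>] 0) (𝓝 0) := by
    intro n hn
    have hb : Tendsto (fun r : ℝ => M * r ^ n) (𝓝[>] 0) (𝓝 0) := by
      have : Tendsto (fun r : ℝ => M * r ^ n) (𝓝 0) (𝓝 (M * 0 ^ n)) := (continuous_const.mul (continuous_pow n)).tendsto 0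
      rw [zero_pow (by omega), mul_zero] at this
      exact this.mono_left nhdsWithin_le_nhds
    refine squeeze_zero_norm' ?_ hb
    filter_upwards [Ioo_mem_nhdsGT (zero_lt_one' ℝ)] with r hr
    rw [Real.norm_eq_abs, abs_mul, abs_of_pos (pow_pos hr.1 n), mul_comm]
    exact mul_le_mul_of_nonneg_right (hM r hr.1 hr.2.le) (pow_nonneg hr.1.le n)
  -- polynomial limits at `0⁺`
  have hlim : ∀ (p : ℝ → ℝ), Continuous p → ∀ (f : ℝ → ℝ), (∀ r : ℝ, 0 < r → f r = p r) →
      Tendsto f (𝓝[>] 0) (𝓝 (p 0)) := by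
    intro p hp f hf
    have h1 : Tendsto p (𝓝[>] 0) (𝓝 (p 0)) := (hp.tendsto 0).mono_left nhdsWithin_le_nhds
    refine h1.congr' ?_
    filter_upwards [self_mem_nhdsWithin] with r hr using (hf r hr).symm
  -- `D = 0`
  have hD : D = 0 := by
    have hf : ∀ r : ℝ, 0 < r → r ^ (2 * l + 1) * H r = A * r ^ (2 * l + 1) + B * r ^ (l + 1) + C * r ^ l + D := by
      intro r hr
      have hr0 : r ≠ 0 := ne_of_gt hr
      rw [hH r hr]
      have e1 : r ^ (2 * l + 1) = r ^ l * r ^ (l + 1) := by rw [← pow_add]; congr 1; omega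
      field_simp
      rw [e1]
      ring
    have h1 := hlim (fun r => A * r ^ (2 * l + 1) + B * r ^ (l + 1) + C * r ^ l + D) (by fun_prop) _ hf
    simp only [zero_pow (show 2 * l + 1 ≠ 0 by omega), zero_pow (show l + 1 ≠ 0 by omega),
      zero_pow (show l ≠ 0 by omega), mul_zero, zero_add] at h1
    exact tendsto_nhds_unique h1 (hsq (2 * l + 1) (by omega))
  -- `C = 0`
  have hC : C = 0 := by
    have hf : ∀ r : ℝ, 0 < r → r ^ (l + 1) * H r = A * r ^ (l + 1) + B * r + C := by
      intro r hr
      have hr0 : r ≠ 0 := ne_of_gt hr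
      rw [hH r hr, hD]
      have e1 : r ^ (l + 1) = r ^ l * r := pow_succ r l
      field_simp
      rw [e1]
      ring
    have h1 := hlim (fun r => A * r ^ (l + 1) + B * r + C) (by fun_prop) _ hf
    simp only [zero_pow (show l + 1 ≠ 0 by omega), mul_zero, zero_add] at h1
    exact tendsto_nhds_unique h1 (hsq (l + 1) (by omega))
  -- `B = 0`
  have hB : B = 0 := by
    have hf : ∀ r : ℝ, 0 < r → r ^ l * H r = A * r ^ l + B := by
      intro r hr
      have hr0 : r ≠ 0 := ne_of_gt hr
      rw [hH r hr, hD, hC]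
      field_simp
      ring
    have h1 := hlim (fun r => A * r ^ l + B) (by fun_prop) _ hf
    simp only [zero_pow (show l ≠ 0 by omega), mul_zero, zero_add] at h1
    exact tendsto_nhds_unique h1 (hsq l hl)
  exact ⟨hB, hC, hD⟩

/-- DECAY ⇒ the constant vanishes: `r^{l+2}|A| ≤ C` on `[1,∞)` forces `A = 0`. -/
theorem const_eq_zero_of_virial_decay {A Cd : ℝ} (l : ℕ) (h : ∀ r : ℝ, 1 ≤ r → r ^ (l + 2) * |A| ≤ Cd) : A = 0 := by
  by_contra hA
  have hA' : 0 < |A| := abs_pos.mpr hA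
  have hC0 : 0 ≤ Cd := le_trans (by positivity) (h 1 le_rfl)
  set r := Cd / |A| + 2 with hr
  have hr1 : 1 ≤ r := by rw [hr]; have := div_nonneg hC0 hA'.le; linarith
  have h1 := h r hr1
  have h2 : r * |A| ≤ r ^ (l + 2) * |A| := by
    apply mul_le_mul_of_nonneg_right _ hA'.le
    calc r = r ^ 1 := (pow_one r).symm
      _ ≤ r ^ (l + 2) := pow_le_pow_right₀ hr1 (by omega)
  have h3 : r * |A| = Cd + 2 * |A| := by rw [hr]; field_simp
  linarith

/-- CONSTANT SQUARE ⇒ CONSTANT: a function continuous on an open interval whose square is constant there is constant there. -/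
theorem exists_const_of_sq_const {f : ℝ → ℝ} {a b c : ℝ} (hf : ContinuousOn f (Ioo a b)) (hsq : ∀ r ∈ Ioo a b, f r ^ 2 = c) :
    ∃ c' : ℝ, ∀ r ∈ Ioo a b, f r = c' := by
  by_cases hne : (Ioo a b).Nonempty
  swap
  · exact ⟨0, fun r hr => absurd ⟨r, hr⟩ hne⟩
  obtain ⟨r₀, hr₀⟩ := hne
  refine ⟨f r₀, fun r hr => ?_⟩
  have hsq' : f r ^ 2 = f r₀ ^ 2 := by rw [hsq r hr, hsq r₀ hr₀]
  rcases sq_eq_sq_iff_eq_or_eq_neg.mp hsq' with h | h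
  · exact h
  · -- `f r = -f r₀`: either both zero, or a sign change forces a zero in between — contradiction
    by_cases h0 : f r₀ = 0
    · rw [h0, neg_zero] at h; rw [h, h0]
    · exfalso
      have hIcc : uIcc r₀ r ⊆ Ioo a b := Set.OrdConnected.uIcc_subset Set.ordConnected_Ioo hr₀ hr
      have hcont : ContinuousOn f (uIcc r₀ r) := hf.mono hIcc
      have hmem : (0 : ℝ) ∈ uIcc (f r₀) (f r) := by
        rw [h, mem_uIcc]
        rcases lt_or_gt_of_ne h0 with hneg | hpos
        · exact Or.inl ⟨hneg.le, by linarith⟩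
        · exact Or.inr ⟨by linarith, hpos.le⟩
      obtain ⟨r₁, hr₁, hfr₁⟩ := intermediate_value_uIcc hcont hmem
      have := hsq r₁ (hIcc hr₁)
      rw [hfr₁] at this
      have hc : c = f r₀ ^ 2 := (hsq r₀ hr₀).symm
      have : f r₀ ^ 2 = 0 := by nlinarith
      exact h0 (pow_eq_zero_iff two_ne_zero |>.mp this)

end Euler

end Summit.NavierStokesRegularity.NavierStokesRegularity.Theorems.UnthreadedRigidity.VirialHorn
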